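import Literature.NumberTheory.GaloisCohomology.Howard2004.SelmerARepresentativeProofs
import Literature.NumberTheory.GaloisCohomology.Howard2004.SelmerAtPresentationProofs
import Literature.NumberTheory.GaloisCohomology.Howard2004.KolyvaginSystemReindex
import HarnessLib

/-!
# Howard 2004, §1.6: `H¹(K, A) = colim_k H¹(K, T/𝔪^{e_k}T)` and `H¹_F(K, A)` along a COFINAL EMBEDDING of towers —
# the colimit side of the transfer `Conclusion S' → Conclusion S` (theorems only)

Topic `NumberTheory/GaloisCohomology/Howard2004` (sequel to `SelmerARepresentativeProofs` — representatives of
`H¹_F(K, A) = selmerA` —, `SelmerAtPresentationProofs` — `H¹` of a presentation `IsQuotientBy` with trivial kernel — and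
`TowerReindex` / `KolyvaginSystemReindex` — cofinal index sequences `idxSeq s₀ d`, iterated reductions `redIter`,
`redIterH1`).  THEOREMS ONLY: no definition, no named fact, no instance, no notation, no `sorry`.

WHY (INPUTS row G87 = `Howard2004.thm161_dvrKolyvaginBound` = Howard Thm. 1.6.1; stub `stub_h161` of the μ-crux
stmt-BirchSwinnertonDyer-22642, binder `h161` of crux 23055's print-leaf census; cell `pub/bsd-print-x9`, seat
`bsd-line-x10b-p1-w7` g8, brick (COFINAL) of `bsd-line-x10b-p1` LEAD g11's interface note
`HOME/p1/COFINAL-SPEC-x10b-p1-g11.md` on the «LEVEL-GAP» finding of x10b-p1-w7 g7).  Howard proves Thm. 1.6.1 on the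
FULL tower `T^{(k)} = T/𝔪^kT` — the `k`-induction of Lemma 1.6.4 uses a level of every exponent (arXiv:1202.6340
p. 12 L3–7) — while the tree's `DVRSetting`s may be gappy (`e` strictly increasing; D1's Eisenstein towers have
`e_k = m(k+1)`).  A kernel `thm161` proved for full settings is CONSUMED on a gappy setting `S` through the transfer
`Conclusion S' → Conclusion S` along a cofinal embedding `S ↪ S'` (marked levels `σ k`, level isomorphisms
`ι_k : T_k ≅ T'_{σ k}`); Howard: «`H¹_F(K, T) = lim H¹_F(K, T/𝔪^kT)`», «`A = T ⊗ 𝒟`» (p. 12 L29, p. 11 L18–20) are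
insensitive to the cofinal system of levels.  This file is the COLIMIT half (claim C2 of the spec) plus the
module-level transition maps it needs, GENERIC over two `AdicTower`s:

* the marked levels are `σ = idxSeq s₀ d` (`σ (k+1) = σ k + d k` by `rfl`, so every compatibility below typechecks
  without index transport; any strictly increasing `σ` is of this form);
* the level isomorphisms are presentations `hιq k : IsQuotientBy (T.ρ k) (I k) (T'.ρ (σ k)) (ι k)` with
  `ker (ι k) = 0`, so `H¹(ι_k)` is the tree's `(hιq k).cohomologyMap 1` / `(hιq k).localCohomologyMap v 1`;
* RED-compatibility `ι_k ∘ red_k = red'^{d k} ∘ ι_{k+1}` (`hιred`), `e' ∘ σ = e` (`heσ`), `π' = π` (`hππ`), and the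
  level conditions at the marked levels are the ones propagated along `ι_k` (`hιF`, `hιA`).

* §1 **`AdicTower.exists_linearMap_incH1LE_eq`** — the transition `T_j → T_{j+D}` of `A = colim` EXISTS AT THE MODULE
  LEVEL: an `R`-linear equivariant `φ` with `φ ∘ red^D = π^{e_{j+D}-e_j}` whose `H¹` is `incH1LE j (j+D)` globally and
  `incLocIter j v D` locally (so `incH1LE` can be compared across towers although `H¹(red)` is not onto);
* §2 `cofinal_cohomologyMap_scalarMapH1` / `_redH1` / **`_incH1`** / **`_incH1LE`** (`H¹(ι_m) ∘ inc_{k→m} =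
  inc'_{σ k→σ m} ∘ H¹(ι_k)`, from `hιred` + `heσ` + `hππ` + `red` onto) / `cofinal_mem_selmerGroup_iff`;
* §3 C2: **`exists_addEquiv_H1A_of_cofinal`** — `Ψ : H¹(K, A) ≃+ H¹(K, A')` with `Ψ [c]_k = [H¹(ι_k) c]_{σ k}`
  (forward `DirectLimit.lift`; injective by `DirectLimit.of.zero_exact` + cofinality + `H¹(ι_m)` injective; onto by
  cofinality + `H¹(ι_m)` onto), **`map_selmerA_le_of_cofinal`**, **`exists_mem_selmerA_map_eq_of_cofinal`** — any such
  `Ψ` carries `H¹_F(K, A)` ONTO `H¹_{F'}(K, A')` when `condA F' (σ k)` is `condA F k` propagated along `ι_k` (`hιA`; on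
  `DVRSetting`s with H.0–H.5 this is `hιF` by `DVRSetting.condA_eq`).

The LIMIT half (C1, C3) is `CofinalEmbeddingLimitProofs`; the `DVRSetting` wrapper `Conclusion S' hy' one' →
Conclusion S hy one` is `ConclusionCofinalTransferProofs`.  HONEST FRAMING: tower/colimit algebra and functoriality
of `H¹`; `thm161_dvrKolyvaginBound` is NOT proved (nor Lemma 1.6.4, nor the refinement constructor (REFINE)); no
summit statement is proved; the Birch–Swinnerton-Dyer conjecture is not proved by any of this.
References: [Howard2004HeegnerKolyvagin] B. Howard, Compositio Math. 140 (2004), §1.6 / Thm. 1.6.1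
(arXiv:1202.6340 Thm. 2.6.1, p. 11 L13–38, p. 12 L29–55), Def. 1.1.3 (p. 5 L93–99); [SerreGaloisCohomology1997]
I §2.2 (functoriality of `H¹`; cohomology of a limit of finite modules).
-/

set_option autoImplicit false

noncomputable section

open Function NumberField IsDedekindDomain Field
open scoped NumberField ContRepresentation

namespace Literature.NumberTheory.GaloisCohomology.Howard2004

open Literature.NumberTheory.GaloisRepresentations
open Literature.NumberTheory.GaloisRepresentations.DiscreteGaloisModule
open Literature.NumberTheory.GaloisRepresentations.galoisCohomology

namespace AdicTower

variable {K : Type} [Field K] [NumberField K] {R : Type} [CommRing R] [IsLocalRing R]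
  {N : ℕ → Type} [∀ k, AddCommGroup (N k)] [∀ k, TopologicalSpace (N k)] [∀ k, DiscreteTopology (N k)]
  [∀ k, Module R (N k)]

/-! ## §1 The iterated transition maps `A[𝔪^{e_j}] ↪ A[𝔪^{e_{j+D}}]` at the module level -/

section Inc

variable (T : AdicTower K R N) (π : R) (e : ℕ → ℕ)
  (hkill : ∀ k, ∀ r ∈ IsLocalRing.maximalIdeal R ^ e k, ∀ x : N k, r • x = 0)
  (hker : ∀ k, LinearMap.ker (T.red k) = (IsLocalRing.maximalIdeal R ^ e k) • (⊤ : Submodule R (N (k + 1))))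
  (hπ : π ∈ IsLocalRing.maximalIdeal R) (he : ∀ k, e k ≤ e (k + 1))

/-- **The iterated transition map `T_j → T_{j+D}` of `A = colim_k T_k` at the MODULE level**: an `R`-linear
`Γ_K`-equivariant `φ` with `φ ∘ red^{D} = π^{e_{j+D}-e_j}` (which determines it), whose `H¹` is `incH1LE j (j+D)`
globally and `incLocIter j v D` at every place. [cite: Howard2004HeegnerKolyvagin, §1.6 (arXiv p. 11 L18–20, p. 12 L40–48)]
[cite: SerreGaloisCohomology1997, Ch. I §2.2] -/
theorem exists_linearMap_incH1LE_eq (j : ℕ) : ∀ D : ℕ,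
    ∃ (φ : N j →ₗ[R] N (j + D)) (hφ : ∀ (g : absoluteGaloisGroup K) (x : N j), φ (T.ρ j g x) = T.ρ (j + D) g (φ x)),
      (∀ y : N (j + D), φ (T.redIter j D y) = π ^ (e (j + D) - e j) • y) ∧
      (∀ c, incH1LE T π e hkill hker hπ he j (j + D) (Nat.le_add_right j D) c =
          ContinuousRep.cohomologyMap (T.ρ j) (T.ρ (j + D)) φ.toAddMonoidHom continuous_of_discreteTopology hφ 1 c) ∧
      (∀ (v : Place K) (c : galoisCohomology ((T.ρ j).toLocal v) 1), incLocIter T π e hkill hker hπ he j v D c =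
          ContinuousRep.cohomologyMap ((T.ρ j).toLocal v) ((T.ρ (j + D)).toLocal v) φ.toAddMonoidHom
            continuous_of_discreteTopology (fun _ x => hφ _ x) 1 c)
  | 0 => by
    refine ⟨LinearMap.id, fun _ _ => rfl, fun y => ?_, fun c => ?_, fun v c => ?_⟩
    · change y = π ^ (e j - e j) • y
      rw [Nat.sub_self, pow_zero, one_smul]
    · have h0 : incH1LE T π e hkill hker hπ he j (j + 0) (Nat.le_add_right j 0) = AddMonoidHom.id _ :=
        Nat.leRec_self _ _
      rw [h0]
      exact (cohomologyMap_one_id_apply (T.ρ j) _ _ (fun _ => rfl) c).symm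
    · exact (cohomologyMap_one_id_apply ((T.ρ j).toLocal v) _ _ (fun _ => rfl) c).symm
  | D + 1 => by
    obtain ⟨φ, hφ, hred, hH1, hloc⟩ := exists_linearMap_incH1LE_eq j D
    have hφ' : ∀ (g : absoluteGaloisGroup K) (x : N j),
        (inc T π e hkill hker hπ he (j + D)).comp φ (T.ρ j g x) = T.ρ (j + D + 1) g ((inc T π e hkill hker hπ he (j + D)).comp φ x) := by
      intro g x
      rw [LinearMap.comp_apply, LinearMap.comp_apply, hφ, inc_equivariant]
    refine ⟨(inc T π e hkill hker hπ he (j + D)).comp φ, hφ', fun y => ?_, fun c => ?_, fun v c => ?_⟩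
    · rw [LinearMap.comp_apply, T.redIter_succ, hred, LinearMap.map_smul, inc_red, smul_smul, ← pow_add]
      have h2 : e j ≤ e (j + D) := (monotone_nat_of_le_succ he) (Nat.le_add_right j D)
      have h3 : e (j + D) ≤ e (j + D + 1) := he (j + D)
      have hsum : e (j + D) - e j + (e (j + D + 1) - e (j + D)) = e (j + D + 1) - e j := by omega
      rw [hsum]
      rfl
    · have h1 : incH1LE T π e hkill hker hπ he j (j + (D + 1)) (Nat.le_add_right j (D + 1)) =
          (incH1 T π e hkill hker hπ he (j + D)).comp (incH1LE T π e hkill hker hπ he j (j + D) (Nat.le_add_right j D)) :=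
        Nat.leRec_succ _ _ (Nat.le_add_right j D)
      rw [h1, AddMonoidHom.comp_apply, hH1]
      exact cohomologyMap_one_comp_eq (T.ρ j) (T.ρ (j + D)) (T.ρ (j + D + 1)) φ.toAddMonoidHom hφ
        (inc T π e hkill hker hπ he (j + D)).toAddMonoidHom (inc_equivariant T π e hkill hker hπ he (j + D))
        _ hφ' (fun _ => rfl) c
    · change incLoc T π e hkill hker hπ he (j + D) v (incLocIter T π e hkill hker hπ he j v D c) = _
      rw [hloc]
      exact cohomologyMap_one_comp_eq ((T.ρ j).toLocal v) ((T.ρ (j + D)).toLocal v) ((T.ρ (j + D + 1)).toLocal v)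
        φ.toAddMonoidHom (fun _ x => hφ _ x)
        (inc T π e hkill hker hπ he (j + D)).toAddMonoidHom (fun _ x => inc_equivariant T π e hkill hker hπ he (j + D) _ x)
        _ (fun _ x => hφ' _ x) (fun _ => rfl) c

end Inc


/-! ## §2 A cofinal embedding of towers: `ι_k : T_k ≅ T'_{σ k}`, `σ = idxSeq s₀ d`, and its `H¹`

The marked levels are `σ = idxSeq s₀ d` (`σ (k+1) = σ k + d k` by `rfl`); the level isomorphisms are
presentations `hιq k : IsQuotientBy (T.ρ k) (I k) (T'.ρ (σ k)) (ι k)` with `ker (ι k) = 0`, so that `H¹(ι_k)` is the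
tree's `(hιq k).cohomologyMap 1` (globally) / `(hιq k).localCohomologyMap v 1` (locally). -/

section Cofinal

variable {N' : ℕ → Type} [∀ k, AddCommGroup (N' k)] [∀ k, TopologicalSpace (N' k)] [∀ k, DiscreteTopology (N' k)]
  [∀ k, Module R (N' k)]
  (T : AdicTower K R N) (T' : AdicTower K R N') (π π' : R) (e e' : ℕ → ℕ)
  (hkill : ∀ k, ∀ r ∈ IsLocalRing.maximalIdeal R ^ e k, ∀ x : N k, r • x = 0)
  (hker : ∀ k, LinearMap.ker (T.red k) = (IsLocalRing.maximalIdeal R ^ e k) • (⊤ : Submodule R (N (k + 1))))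
  (hπ : π ∈ IsLocalRing.maximalIdeal R) (he : ∀ k, e k ≤ e (k + 1))
  (hkill' : ∀ k, ∀ r ∈ IsLocalRing.maximalIdeal R ^ e' k, ∀ x : N' k, r • x = 0)
  (hker' : ∀ k, LinearMap.ker (T'.red k) = (IsLocalRing.maximalIdeal R ^ e' k) • (⊤ : Submodule R (N' (k + 1))))
  (hπ' : π' ∈ IsLocalRing.maximalIdeal R) (he' : ∀ k, e' k ≤ e' (k + 1))
  (s₀ : ℕ) (d : ℕ → ℕ) {I : ℕ → Ideal R}
  {ι : ∀ k, N k →ₗ[R] N' (idxSeq s₀ d k)}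
  (hιq : ∀ k, IsQuotientBy (T.ρ k) (I k) (T'.ρ (idxSeq s₀ d k)) (ι k))

omit [NumberField K] in
/-- `H¹(ι_k)` commutes with the scalars: `H¹(ι_k)(r • c) = r • H¹(ι_k) c`. [cite: Howard2004HeegnerKolyvagin, §1.6 (arXiv p. 12, L29)] -/
theorem cofinal_cohomologyMap_scalarMapH1 (k : ℕ) (r : R) (c : galoisCohomology (T.ρ k) 1) :
    (hιq k).cohomologyMap 1 (scalarMapH1 (T.ρ k) (T.hlin k) r c) =
      scalarMapH1 (T'.ρ (idxSeq s₀ d k)) (T'.hlin (idxSeq s₀ d k)) r ((hιq k).cohomologyMap 1 c) :=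
  cohomologyMap_scalarMapH1 (T.hlin k) (T'.hlin (idxSeq s₀ d k)) (ι k) (hιq k).equivariant r c

omit [NumberField K] in
/-- **Reduction compatibility on `H¹`**: `H¹(ι_k) ∘ H¹(red_k) = H¹(red'^{d k}) ∘ H¹(ι_{k+1})` (from
`ι_k ∘ red_k = red'_{σ k ← σ(k+1)} ∘ ι_{k+1}`). [cite: Howard2004HeegnerKolyvagin, §1.6 (arXiv p. 12, L29–33)] -/
theorem cofinal_cohomologyMap_redH1
    (hιred : ∀ k (y : N (k + 1)), ι k (T.red k y) = T'.redIter (idxSeq s₀ d k) (d k) (ι (k + 1) y))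
    (k : ℕ) (c : galoisCohomology (T.ρ (k + 1)) 1) :
    (hιq k).cohomologyMap 1 (T.redH1 k c) =
      T'.redIterH1 (idxSeq s₀ d k) (d k) ((hιq (k + 1)).cohomologyMap 1 c) :=
  cohomologyMap_one_comm_sq (T.ρ (k + 1)) (T.ρ k) (T'.ρ (idxSeq s₀ d (k + 1))) (T'.ρ (idxSeq s₀ d k))
    (T.red k).toAddMonoidHom (T.red_equivariant k) (ι k).toAddMonoidHom (hιq k).equivariant
    (ι (k + 1)).toAddMonoidHom (hιq (k + 1)).equivariant
    (T'.redIter (idxSeq s₀ d k) (d k)).toAddMonoidHom (T'.redIter_equivariant (idxSeq s₀ d k) (d k))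
    (fun y => hιred k y) c

/-- **Transition compatibility on `H¹` (one step)**: `H¹(ι_{k+1}) ∘ H¹(inc_k) = inc'_{σ k → σ(k+1)} ∘ H¹(ι_k)`
(both are `π^{e_{k+1}-e_k}` on a lift: `ι ∘ red = red' ∘ ι`, `e' ∘ σ = e`, `π' = π`).
[cite: Howard2004HeegnerKolyvagin, §1.6 (arXiv p. 11 L18–20, p. 12 L40–48)] -/
theorem cofinal_cohomologyMap_incH1 (hππ : π' = π) (heσ : ∀ k, e' (idxSeq s₀ d k) = e k)
    (hιred : ∀ k (y : N (k + 1)), ι k (T.red k y) = T'.redIter (idxSeq s₀ d k) (d k) (ι (k + 1) y))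
    (k : ℕ) (c : galoisCohomology (T.ρ k) 1) :
    (hιq (k + 1)).cohomologyMap 1 (incH1 T π e hkill hker hπ he k c) =
      incH1LE T' π' e' hkill' hker' hπ' he' (idxSeq s₀ d k) (idxSeq s₀ d (k + 1)) (idxSeq_le_succ s₀ d k)
        ((hιq k).cohomologyMap 1 c) := by
  subst hππ
  obtain ⟨φ, hφ, hφred, hφH1, -⟩ := exists_linearMap_incH1LE_eq T' π' e' hkill' hker' hπ' he' (idxSeq s₀ d k) (d k)
  refine Eq.trans ?_ (hφH1 _).symm
  symm
  refine cohomologyMap_one_comm_sq (T.ρ k) (T'.ρ (idxSeq s₀ d k)) (T.ρ (k + 1)) (T'.ρ (idxSeq s₀ d (k + 1)))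
    (ι k).toAddMonoidHom (hιq k).equivariant φ.toAddMonoidHom hφ
    (inc T π' e hkill hker hπ' he k).toAddMonoidHom (inc_equivariant T π' e hkill hker hπ' he k)
    (ι (k + 1)).toAddMonoidHom (hιq (k + 1)).equivariant (fun x => ?_) c
  obtain ⟨y, rfl⟩ := T.red_surjective k x
  change φ (ι k (T.red k y)) = ι (k + 1) (inc T π' e hkill hker hπ' he k (T.red k y))
  rw [hιred, hφred, inc_red, LinearMap.map_smul, heσ]
  change π' ^ (e' (idxSeq s₀ d (k + 1)) - e k) • ι (k + 1) y = _
  rw [heσ]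

/-- **Transition compatibility on `H¹` (all steps)**: `H¹(ι_m) ∘ inc_{k → m} = inc'_{σ k → σ m} ∘ H¹(ι_k)`.
[cite: Howard2004HeegnerKolyvagin, §1.6 (arXiv p. 11 L18–20, p. 12 L40–48)] -/
theorem cofinal_cohomologyMap_incH1LE (hππ : π' = π) (heσ : ∀ k, e' (idxSeq s₀ d k) = e k)
    (hιred : ∀ k (y : N (k + 1)), ι k (T.red k y) = T'.redIter (idxSeq s₀ d k) (d k) (ι (k + 1) y))
    (k : ℕ) : ∀ (m : ℕ) (h : k ≤ m) (c : galoisCohomology (T.ρ k) 1),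
    (hιq m).cohomologyMap 1 (incH1LE T π e hkill hker hπ he k m h c) =
      incH1LE T' π' e' hkill' hker' hπ' he' (idxSeq s₀ d k) (idxSeq s₀ d m) (idxSeq_monotone s₀ d h)
        ((hιq k).cohomologyMap 1 c) := by
  intro m h
  induction h with
  | refl =>
    intro c
    have h0 : incH1LE T π e hkill hker hπ he k k le_rfl = AddMonoidHom.id _ := Nat.leRec_self _ _
    have h0' : incH1LE T' π' e' hkill' hker' hπ' he' (idxSeq s₀ d k) (idxSeq s₀ d k)
        (idxSeq_monotone s₀ d (le_refl k)) = AddMonoidHom.id _ := Nat.leRec_self _ _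
    rw [h0, h0']
    rfl
  | @step m hle ih =>
    intro c
    have h1 : incH1LE T π e hkill hker hπ he k (m + 1) (Nat.le.step hle) =
        (incH1 T π e hkill hker hπ he m).comp (incH1LE T π e hkill hker hπ he k m hle) :=
      Nat.leRec_succ _ _ hle
    rw [h1, AddMonoidHom.comp_apply, cofinal_cohomologyMap_incH1 T T' π π' e e' hkill hker hπ he hkill' hker'
      hπ' he' s₀ d hιq hππ heσ hιred, ih,
      incH1LE_incH1LE T' π' e' hkill' hker' hπ' he']

/-- **Selmer compatibility at the marked levels**: if the condition at the marked level is the one propagated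
along `ι_k`, `H¹(ι_k)` identifies the Selmer groups. [cite: Howard2004HeegnerKolyvagin, Def. 1.1.3 and §1.6 (arXiv p. 5 L93–99, p. 12 L29–33)] -/
theorem cofinal_mem_selmerGroup_iff (hιk : ∀ k, LinearMap.ker (ι k) = ⊥)
    (F : ∀ k, SelmerStructure (T.ρ k)) (F' : ∀ k, SelmerStructure (T'.ρ k))
    (hιF : ∀ k, (hιq k).propagateStructure (F k) = F' (idxSeq s₀ d k))
    (k : ℕ) (c : galoisCohomology (T.ρ k) 1) :
    c ∈ (F k).selmerGroup ↔ (hιq k).cohomologyMap 1 c ∈ (F' (idxSeq s₀ d k)).selmerGroup := by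
  rw [← hιF k, (hιq k).cohomologyMap_mem_selmerGroup_propagateStructure_iff (hιk k)]

/-! ## §3 (C2) The colimit side: `H¹(K, A) ≅ H¹(K, A′)` along the cofinal embedding, `H¹_F(K, A) ↦ H¹_{F′}(K, A′)` -/

/-- **(C2, existence) `H¹(K, A) = colim_k H¹(K, T_k) ≃ colim_j H¹(K, T′_j) = H¹(K, A′)`** along a cofinal embedding:
the additive bijection `Ψ` with `Ψ [c]_k = [H¹(ι_k) c]_{σ k}` (forward map = `DirectLimit.lift`, well defined by the
transition compatibility; injective by `DirectLimit.of.zero_exact` + cofinality + injectivity of `H¹(ι_m)`; surjective by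
cofinality + surjectivity of `H¹(ι_m)`). [cite: Howard2004HeegnerKolyvagin, §1.6 / Thm. 1.6.1 (arXiv p. 11 L18–28, p. 12 L29–48)] -/
theorem exists_addEquiv_H1A_of_cofinal (hππ : π' = π) (heσ : ∀ k, e' (idxSeq s₀ d k) = e k)
    (hιk : ∀ k, LinearMap.ker (ι k) = ⊥)
    (hιred : ∀ k (y : N (k + 1)), ι k (T.red k y) = T'.redIter (idxSeq s₀ d k) (d k) (ι (k + 1) y))
    (hcof : ∀ j, ∃ m, j ≤ idxSeq s₀ d m) :
    ∃ Ψ : H1A T π e hkill hker hπ he ≃+ H1A T' π' e' hkill' hker' hπ' he',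
      ∀ (k : ℕ) (c : galoisCohomology (T.ρ k) 1),
        Ψ (AddCommGroup.DirectLimit.of (fun k => galoisCohomology (T.ρ k) 1) (incH1LE T π e hkill hker hπ he) k c) =
          AddCommGroup.DirectLimit.of (fun j => galoisCohomology (T'.ρ j) 1) (incH1LE T' π' e' hkill' hker' hπ' he')
            (idxSeq s₀ d k) ((hιq k).cohomologyMap 1 c) := by
  haveI := directedSystem_incH1LE T π e hkill hker hπ he
  haveI := directedSystem_incH1LE T' π' e' hkill' hker' hπ' he'
  let Ψ₀ : H1A T π e hkill hker hπ he →+ H1A T' π' e' hkill' hker' hπ' he' :=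
    AddCommGroup.DirectLimit.lift _ _ _
      (fun k => (AddCommGroup.DirectLimit.of (fun j => galoisCohomology (T'.ρ j) 1)
        (incH1LE T' π' e' hkill' hker' hπ' he') (idxSeq s₀ d k)).comp ((hιq k).cohomologyMap 1))
      (fun k m hkm c => by
        rw [AddMonoidHom.comp_apply, AddMonoidHom.comp_apply,
          cofinal_cohomologyMap_incH1LE T T' π π' e e' hkill hker hπ he hkill' hker' hπ' he' s₀ d hιq hππ heσ
            hιred k m hkm c, AddCommGroup.DirectLimit.of_f])
  have hΨ₀ : ∀ (k : ℕ) (c : galoisCohomology (T.ρ k) 1),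
      Ψ₀ (AddCommGroup.DirectLimit.of (fun k => galoisCohomology (T.ρ k) 1) (incH1LE T π e hkill hker hπ he) k c) =
        AddCommGroup.DirectLimit.of (fun j => galoisCohomology (T'.ρ j) 1) (incH1LE T' π' e' hkill' hker' hπ' he')
          (idxSeq s₀ d k) ((hιq k).cohomologyMap 1 c) :=
    fun k c => AddCommGroup.DirectLimit.lift_of _ _ _ _ _
  have hinj : Function.Injective Ψ₀ := by
    rw [injective_iff_map_eq_zero]
    intro a ha
    obtain ⟨k, c, rfl⟩ := exists_of_eq T π e hkill hker hπ he a
    rw [hΨ₀] at ha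
    obtain ⟨j, hkj, hj⟩ := AddCommGroup.DirectLimit.of.zero_exact _ _ ha
    obtain ⟨m₀, hm₀⟩ := hcof j
    have hkm : k ≤ max m₀ k := le_max_right _ _
    have hjm : j ≤ idxSeq s₀ d (max m₀ k) := hm₀.trans (idxSeq_monotone s₀ d (le_max_left _ _))
    have h1 : incH1LE T' π' e' hkill' hker' hπ' he' (idxSeq s₀ d k) (idxSeq s₀ d (max m₀ k))
        (idxSeq_monotone s₀ d hkm) ((hιq k).cohomologyMap 1 c) = 0 := by
      rw [← incH1LE_incH1LE T' π' e' hkill' hker' hπ' he' (idxSeq s₀ d k) j hkj (idxSeq s₀ d (max m₀ k)) hjm,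
        hj, map_zero]
    rw [← cofinal_cohomologyMap_incH1LE T T' π π' e e' hkill hker hπ he hkill' hker' hπ' he' s₀ d hιq hππ heσ
      hιred k (max m₀ k) hkm c] at h1
    have h2 : incH1LE T π e hkill hker hπ he k (max m₀ k) hkm c = 0 :=
      ((hιq (max m₀ k)).bijective_cohomologyMap_of_ker_eq_bot (hιk _)).1 (h1.trans (map_zero _).symm)
    rw [← AddCommGroup.DirectLimit.of_f (G := fun k => galoisCohomology (T.ρ k) 1)
      (f := incH1LE T π e hkill hker hπ he) hkm c, h2, map_zero]
  have hsurj : Function.Surjective Ψ₀ := by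
    intro b
    obtain ⟨j, c', rfl⟩ := exists_of_eq T' π' e' hkill' hker' hπ' he' b
    obtain ⟨m, hjm⟩ := hcof j
    obtain ⟨c, hc⟩ := ((hιq m).bijective_cohomologyMap_of_ker_eq_bot (hιk m)).2
      (incH1LE T' π' e' hkill' hker' hπ' he' j (idxSeq s₀ d m) hjm c')
    refine ⟨AddCommGroup.DirectLimit.of (fun k => galoisCohomology (T.ρ k) 1) (incH1LE T π e hkill hker hπ he) m c, ?_⟩
    rw [hΨ₀, hc, AddCommGroup.DirectLimit.of_f]
  exact ⟨AddEquiv.ofBijective Ψ₀ ⟨hinj, hsurj⟩, fun k c => hΨ₀ k c⟩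

/-- **(C2, Selmer part, ⊆)**: any additive `Ψ` with `Ψ [c]_k = [H¹(ι_k) c]_{σ k}` carries `H¹_F(K, A)` into
`H¹_{F′}(K, A′)` when the propagated conditions `condA F′ (σ k)` are the ones propagated from `condA F k` along `ι_k`.
[cite: Howard2004HeegnerKolyvagin, §1.6 / Thm. 1.6.1 (arXiv p. 11 L18–28, p. 12 L40–48)] -/
theorem map_selmerA_le_of_cofinal (hιk : ∀ k, LinearMap.ker (ι k) = ⊥)
    (F : ∀ k, SelmerStructure (T.ρ k)) (F' : ∀ k, SelmerStructure (T'.ρ k))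
    (hred : ∀ (k : ℕ) (v : Place K), ((F (k + 1)) v).map
      (ContinuousRep.cohomologyMap ((T.ρ (k + 1)).toLocal v) ((T.ρ k).toLocal v)
        (T.red k).toAddMonoidHom continuous_of_discreteTopology
        (fun _ x => T.red_equivariant k _ x) 1) = F k v)
    (hsmul : ∀ (k : ℕ) (v : Place K) (r : R), (F k v).map
      (scalarMapH1 ((T.ρ k).toLocal v) ((T.hlin k).restrictField _) r) ≤ F k v)
    (hred' : ∀ (k : ℕ) (v : Place K), ((F' (k + 1)) v).map
      (ContinuousRep.cohomologyMap ((T'.ρ (k + 1)).toLocal v) ((T'.ρ k).toLocal v)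
        (T'.red k).toAddMonoidHom continuous_of_discreteTopology
        (fun _ x => T'.red_equivariant k _ x) 1) = F' k v)
    (hsmul' : ∀ (k : ℕ) (v : Place K) (r : R), (F' k v).map
      (scalarMapH1 ((T'.ρ k).toLocal v) ((T'.hlin k).restrictField _) r) ≤ F' k v)
    (hιA : ∀ k, (hιq k).propagateStructure (condA T π e hkill hker hπ he F k) =
      condA T' π' e' hkill' hker' hπ' he' F' (idxSeq s₀ d k))
    (Ψ : H1A T π e hkill hker hπ he →+ H1A T' π' e' hkill' hker' hπ' he')
    (hΨ : ∀ (k : ℕ) (c : galoisCohomology (T.ρ k) 1),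
      Ψ (AddCommGroup.DirectLimit.of (fun k => galoisCohomology (T.ρ k) 1) (incH1LE T π e hkill hker hπ he) k c) =
        AddCommGroup.DirectLimit.of (fun j => galoisCohomology (T'.ρ j) 1) (incH1LE T' π' e' hkill' hker' hπ' he')
          (idxSeq s₀ d k) ((hιq k).cohomologyMap 1 c)) :
    (selmerA T π e hkill hker hπ he F).map Ψ ≤ selmerA T' π' e' hkill' hker' hπ' he' F' := by
  rintro _ ⟨a, ha, rfl⟩
  obtain ⟨k, c, hc, rfl⟩ := (mem_selmerA_iff T π e hkill hker hπ he F hred hsmul a).1 ha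
  rw [hΨ]
  refine (mem_selmerA_iff T' π' e' hkill' hker' hπ' he' F' hred' hsmul' _).2 ⟨idxSeq s₀ d k, _, ?_, rfl⟩
  exact (cofinal_mem_selmerGroup_iff T T' s₀ d hιq hιk (fun k => condA T π e hkill hker hπ he F k)
    (fun j => condA T' π' e' hkill' hker' hπ' he' F' j) hιA k c).1 hc

/-- **(C2, Selmer part, ⊇)**: every class of `H¹_{F′}(K, A′)` is `Ψ` of a class of `H¹_F(K, A)` (cofinality, Selmer classes
go up along `inc′`, surjectivity of `H¹(ι_m)`, and the identification of the propagated conditions at the marked levels).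
[cite: Howard2004HeegnerKolyvagin, §1.6 / Thm. 1.6.1 (arXiv p. 11 L18–28, p. 12 L40–48)] -/
theorem exists_mem_selmerA_map_eq_of_cofinal (hιk : ∀ k, LinearMap.ker (ι k) = ⊥)
    (hcof : ∀ j, ∃ m, j ≤ idxSeq s₀ d m)
    (F : ∀ k, SelmerStructure (T.ρ k)) (F' : ∀ k, SelmerStructure (T'.ρ k))
    (hred' : ∀ (k : ℕ) (v : Place K), ((F' (k + 1)) v).map
      (ContinuousRep.cohomologyMap ((T'.ρ (k + 1)).toLocal v) ((T'.ρ k).toLocal v)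
        (T'.red k).toAddMonoidHom continuous_of_discreteTopology
        (fun _ x => T'.red_equivariant k _ x) 1) = F' k v)
    (hsmul' : ∀ (k : ℕ) (v : Place K) (r : R), (F' k v).map
      (scalarMapH1 ((T'.ρ k).toLocal v) ((T'.hlin k).restrictField _) r) ≤ F' k v)
    (hιA : ∀ k, (hιq k).propagateStructure (condA T π e hkill hker hπ he F k) =
      condA T' π' e' hkill' hker' hπ' he' F' (idxSeq s₀ d k))
    (Ψ : H1A T π e hkill hker hπ he →+ H1A T' π' e' hkill' hker' hπ' he')
    (hΨ : ∀ (k : ℕ) (c : galoisCohomology (T.ρ k) 1),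
      Ψ (AddCommGroup.DirectLimit.of (fun k => galoisCohomology (T.ρ k) 1) (incH1LE T π e hkill hker hπ he) k c) =
        AddCommGroup.DirectLimit.of (fun j => galoisCohomology (T'.ρ j) 1) (incH1LE T' π' e' hkill' hker' hπ' he')
          (idxSeq s₀ d k) ((hιq k).cohomologyMap 1 c))
    {b : H1A T' π' e' hkill' hker' hπ' he'} (hb : b ∈ selmerA T' π' e' hkill' hker' hπ' he' F') :
    ∃ a ∈ selmerA T π e hkill hker hπ he F, Ψ a = b := by
  obtain ⟨j, c', hc', rfl⟩ := (mem_selmerA_iff T' π' e' hkill' hker' hπ' he' F' hred' hsmul' b).1 hb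
  obtain ⟨m, hjm⟩ := hcof j
  have hc'' := incH1LE_mem_selmerGroup_condA T' π' e' hkill' hker' hπ' he' F' hred' hsmul' j (idxSeq s₀ d m) hjm hc'
  obtain ⟨c, hc⟩ := ((hιq m).bijective_cohomologyMap_of_ker_eq_bot (hιk m)).2
    (incH1LE T' π' e' hkill' hker' hπ' he' j (idxSeq s₀ d m) hjm c')
  rw [← hc] at hc''
  have hcm : c ∈ (condA T π e hkill hker hπ he F m).selmerGroup :=
    (cofinal_mem_selmerGroup_iff T T' s₀ d hιq hιk (fun k => condA T π e hkill hker hπ he F k)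
      (fun j => condA T' π' e' hkill' hker' hπ' he' F' j) hιA m c).2 hc''
  refine ⟨AddCommGroup.DirectLimit.of (fun k => galoisCohomology (T.ρ k) 1) (incH1LE T π e hkill hker hπ he) m c,
    AddSubgroup.mem_iSup_of_mem m ⟨c, hcm, rfl⟩, ?_⟩
  rw [hΨ, hc, AddCommGroup.DirectLimit.of_f]

end Cofinal

end AdicTower

end Literature.NumberTheory.GaloisCohomology.Howard2004

end
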